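import Mathlib

/-!
# `TwinAlgMuZeroAtThree` · card `one-point-squeeze` · g73 TWIST AUDIT of U1-glob (kernel pieces)

Seat `bsd-wall-utd-idea` g73 (ideation planner, crux item stmt-BirchSwinnertonDyer-24737).  Mathlib only,
no `sorry`, nothing here is a tree theorem about the summit: these are the finite-group / linear-algebra
MODELS of the three χ-specific checks in the g73 amendment of `Ideas/one-point-squeeze.md`
(«U1-glob is Howard 2004 Thm 1.6.1 VERBATIM over `O_χ`»), each with its dictionary.

* §1 (T-b) = Howard 2004 Remark 1.3.2 / Lemma 2.1.1 (arXiv:1202.6340 p. 7 L129–150, p. 15 L77–95):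
  from a skew, Galois-equivariant pairing `e : T × T → R(1)` and complex conjugation `τ` (`τ² = 1`,
  `χ_cyc(τ) = -1`) the recipe `(s,t) := e(s, τ t)` is SYMMETRIC, satisfies Howard's H.4 identity
  `(σ s, (τστ) t) = χ_cyc(σ)·(s,t)`, stays perfect, and — the twist check — keeps the H.4 identity for the
  twisted action `σ ↦ χ(σ)⁻¹·ρ(σ)` EXACTLY WHEN `χ(τστ) = χ(σ)⁻¹` (χ anticyclotomic).
  Dictionary: `M = T₃E′ ⊗ O_χ`, `ρ` = the diagonal action with trivial action on `O_χ`, `c = χ_cyc`,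
  `χ` = the finite-order character of `Γ = Gal(K_∞/K)`; the twisted action is `T_χ = T ⊗ O_χ(χ̄)`.
* §2 (T-a) = the χ-dependent term of H.2 for `F_χ = K_m·K(E′[3^∞])`: in the inflation–restriction
  sequence for `A = Gal(F_χ/K(E′[3^∞])) ⊴ G = Gal(F_χ/K)`, `A` is CENTRAL (it injects into the abelian
  `Gal(K_m/K)` compatibly with conjugation) and acts trivially on `V = E′[3] ⊗ k`; then every 1-cocycle
  of `G` restricts to zero on `A` as soon as `V^G = 0` (`E′(K)[3] = 0`), so `H¹(G,V) = 0` follows from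
  `H¹(G/A, V) = 0` (the χ-free term, Howard p. 12 L91–95 / audit g53 Δ1).  (Howard's own route for
  `T ⊗ S_𝔭`, p. 15 L131–142, runs the sequence through `K_∞` instead; either way the term is m-uniform.)
* §3 (T-c) = H.5(b) for the Bloch–Kato condition on `T_χ`: the coefficient involution `ι : ζ ↦ ζ⁻¹` of
  `O_χ = ℤ₃[ζ_{3^m}]` is the identity on the residue field because `ζ⁻¹ − ζ ∈ (1 − ζ) = 𝔪_χ`; hence the
  ι-semilinear `G_K`-bijection `T ⊗ O_χ(χ) ≃ T ⊗ O_χ(χ̄)` reduces to the identity on `T̄ ⊗ k` and carries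
  the residual local condition of `T_χ` at `v̄` (transported by `τ`, which turns `χ` into `χ̄ = χ∘Ad τ`)
  onto that of `T_χ` at `v`.
-/

namespace Summit.BirchSwinnertonDyer.BirchSwinnertonDyer.Cruxes.TwinAlgMuZeroAtThree.OnePointSqueeze.TwistAudit

/-! ## §1  Howard's pairing recipe and the anticyclotomic twist (T-b) -/

section Pairing

variable {R : Type*} [CommRing R] {M : Type*} [AddCommGroup M] [Module R M]
variable {G : Type*} [Group G]

/-- Howard's recipe: `f s t = e s (ρ τ t)`. -/
def howardPairing (e : M →ₗ[R] M →ₗ[R] R) (ρ : Representation R G M) (τ : G) :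
    M →ₗ[R] M →ₗ[R] R :=
  e.compl₂ (ρ τ)

@[simp] theorem howardPairing_apply (e : M →ₗ[R] M →ₗ[R] R) (ρ : Representation R G M) (τ : G)
    (s t : M) : howardPairing e ρ τ s t = e s (ρ τ t) := rfl

variable (e : M →ₗ[R] M →ₗ[R] R) (ρ : Representation R G M) (c : G →* Rˣ) (τ : G)

/-- `ρ τ (ρ τ t) = t` when `τ * τ = 1`. -/
theorem rho_tau_rho_tau (hτ : τ * τ = 1) (t : M) : ρ τ (ρ τ t) = t := by
  have h : ρ τ * ρ τ = 1 := by rw [← map_mul, hτ, map_one]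
  have := congrArg (fun φ : M →ₗ[R] M => φ t) h
  simpa using this

/-- SYMMETRY (Howard H.4 «perfect, symmetric»): if `e` is skew (`e s t = - e t s`), `G`-equivariant up to
the character `c` (`e (g s) (g t) = c g · e s t`), `τ² = 1` and `c τ = -1`, then `(s,t) := e(s, τ t)` is
symmetric. -/
theorem howardPairing_symm
    (hskew : ∀ s t, e s t = - e t s)
    (hequiv : ∀ g s t, e (ρ g s) (ρ g t) = (c g : R) * e s t)
    (hτ : τ * τ = 1) (hcτ : (c τ : R) = -1) (s t : M) :
    howardPairing e ρ τ t s = howardPairing e ρ τ s t := by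
  simp only [howardPairing_apply]
  have h1 : e (ρ τ s) t = (c τ : R) * e s (ρ τ t) := by
    have := hequiv τ s (ρ τ t)
    rwa [rho_tau_rho_tau ρ τ hτ] at this
  rw [hskew t (ρ τ s), h1, hcτ]
  ring

/-- HOWARD'S H.4 IDENTITY `(s^σ, t^{τστ}) = (s,t)^σ` for the recipe. -/
theorem howardPairing_equivariance
    (hequiv : ∀ g s t, e (ρ g s) (ρ g t) = (c g : R) * e s t)
    (hτ : τ * τ = 1) (g : G) (s t : M) :
    howardPairing e ρ τ (ρ g s) (ρ (τ * g * τ) t) = (c g : R) * howardPairing e ρ τ s t := by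
  simp only [howardPairing_apply]
  have h : ρ τ (ρ (τ * g * τ) t) = ρ g (ρ τ t) := by
    have hm : τ * (τ * g * τ) = g * τ := by
      rw [← mul_assoc, ← mul_assoc, hτ, one_mul]
    have := congrArg (fun φ : M →ₗ[R] M => φ t) (show ρ τ * ρ (τ * g * τ) = ρ g * ρ τ by
      rw [← map_mul, ← map_mul, hm])
    simpa using this
  rw [h, hequiv]

/-- PERFECTNESS is kept: if `e` is left-separating then so is the recipe (`ρ τ` is an involution). -/
theorem howardPairing_separatingLeft
    (hsep : ∀ s, (∀ t, e s t = 0) → s = 0) (hτ : τ * τ = 1) (s : M)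
    (h : ∀ t, howardPairing e ρ τ s t = 0) : s = 0 := by
  apply hsep
  intro t
  have := h (ρ τ t)
  rwa [howardPairing_apply, rho_tau_rho_tau ρ τ hτ] at this

/-- THE TWIST CHECK (T-b).  Twist the action by a character: `σ ↦ a σ • ρ σ` with `a σ = χ(σ)⁻¹`
(this is `T ⊗ O(χ̄)` with the diagonal action).  Howard's H.4 identity survives for the SAME pairing iff the
scalar `a σ · a (τστ)` is `1`, i.e. iff `χ(τστ) = χ(σ)⁻¹`: χ ANTICYCLOTOMIC.  (Howard 2004 Lemma 2.1.1 is the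
case `χ` = the universal character `G_K → Λ^× → S_𝔭^×`.) -/
theorem howardPairing_twist_equivariance
    (hequiv : ∀ g s t, e (ρ g s) (ρ g t) = (c g : R) * e s t)
    (hτ : τ * τ = 1) (χ : G →* Rˣ) (hχ : ∀ g, χ (τ * g * τ) = (χ g)⁻¹) (g : G) (s t : M) :
    howardPairing e ρ τ (((χ g)⁻¹ : Rˣ) • ρ g s) (((χ (τ * g * τ))⁻¹ : Rˣ) • ρ (τ * g * τ) t)
      = (c g : R) * howardPairing e ρ τ s t := by
  have key : e (ρ g s) (ρ τ (ρ (τ * g * τ) t)) = (c g : R) * e s (ρ τ t) := by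
    have := howardPairing_equivariance e ρ c τ hequiv hτ g s t
    simpa only [howardPairing_apply] using this
  rw [hχ g, inv_inv]
  simp only [howardPairing_apply, Units.smul_def, map_smul, LinearMap.smul_apply, smul_eq_mul]
  rw [key, ← mul_assoc, ← mul_assoc, Units.mul_inv, one_mul]

/-- The scalar the twist produces in general is `χ(g)⁻¹ · χ(τgτ)⁻¹`: the H.4 identity for the twisted
action holds up to exactly this factor (so it holds on the nose iff the factor is `1` wherever the pairing
is nonzero — a CYCLOTOMIC twist, `χ(τgτ) = χ(g)`, breaks H.4; Howard's framework is anticyclotomic). -/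
theorem howardPairing_twist_general
    (hequiv : ∀ g s t, e (ρ g s) (ρ g t) = (c g : R) * e s t)
    (hτ : τ * τ = 1) (χ : G →* Rˣ) (g : G) (s t : M) :
    howardPairing e ρ τ (((χ g)⁻¹ : Rˣ) • ρ g s) (((χ (τ * g * τ))⁻¹ : Rˣ) • ρ (τ * g * τ) t)
      = (((χ g)⁻¹ : Rˣ) : R) * (((χ (τ * g * τ))⁻¹ : Rˣ) : R) * ((c g : R) * howardPairing e ρ τ s t) := by
  have key : e (ρ g s) (ρ τ (ρ (τ * g * τ) t)) = (c g : R) * e s (ρ τ t) := by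
    have := howardPairing_equivariance e ρ c τ hequiv hτ g s t
    simpa only [howardPairing_apply] using this
  simp only [howardPairing_apply, Units.smul_def, map_smul, LinearMap.smul_apply, smul_eq_mul]
  rw [key]
  ring

end Pairing

/-! ## §2  The χ-dependent term of H.2 vanishes (T-a): hands-on 1-cocycles -/

section Cocycles

variable {G : Type*} [Group G] {V : Type*} [AddCommGroup V] [DistribMulAction G V]

/-- 1-cocycle (crossed homomorphism); a structure, so that no untagged `def … : Prop` enters the tree. -/
structure IsOneCocycle (f : G → V) : Prop where
  mul : ∀ g h : G, f (g * h) = f g + g • f h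

/-- 1-coboundary. -/
structure IsOneCoboundary (f : G → V) : Prop where
  out : ∃ v : V, ∀ g : G, f g = g • v - v

theorem IsOneCocycle.map_one {f : G → V} (hf : IsOneCocycle f) : f 1 = 0 := by
  have h := hf.mul 1 1
  rw [mul_one, one_smul] at h
  -- h : f 1 = f 1 + f 1
  have : f 1 + f 1 = f 1 + 0 := by rw [add_zero]; exact h.symm
  exact add_left_cancel this

theorem IsOneCocycle.smul_map_inv {f : G → V} (hf : IsOneCocycle f) (g : G) :
    g • f g⁻¹ = - f g := by
  have h := hf.mul g g⁻¹
  rw [mul_inv_cancel, hf.map_one] at h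
  -- h : 0 = f g + g • f g⁻¹
  exact (neg_eq_of_add_eq_zero_right h.symm).symm

/-- Conjugation formula: if `a` acts trivially on `V` then `f (g a g⁻¹) = g • f a`. -/
theorem IsOneCocycle.map_conj {f : G → V} (hf : IsOneCocycle f) (g a : G)
    (ha : ∀ v : V, a • v = v) : f (g * a * g⁻¹) = g • f a := by
  rw [hf.mul (g * a) g⁻¹, hf.mul g a, mul_smul, ha, hf.smul_map_inv g]
  abel

/-- (T-a) If `A ≤ Z(G)` acts trivially on `V` and `V^G = 0`, every 1-cocycle vanishes on `A`. -/
theorem cocycle_restrict_eq_zero (A : Subgroup G)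
    (hAZ : A ≤ Subgroup.center G) (hAV : ∀ a ∈ A, ∀ v : V, a • v = v)
    (hVG : ∀ v : V, (∀ g : G, g • v = v) → v = 0)
    {f : G → V} (hf : IsOneCocycle f) : ∀ a ∈ A, f a = 0 := by
  intro a ha
  apply hVG
  intro g
  have hcomm : g * a * g⁻¹ = a := by
    have hc := Subgroup.mem_center_iff.mp (hAZ ha) g
    rw [hc, mul_inv_cancel_right]
  rw [← hf.map_conj g a (hAV a ha), hcomm]

/-- A cocycle vanishing on `A` (acting trivially) is constant on `A`-cosets: it is inflated from `G/A`. -/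
theorem cocycle_mul_of_restrict_eq_zero (A : Subgroup G) (_hAV : ∀ a ∈ A, ∀ v : V, a • v = v)
    {f : G → V} (hf : IsOneCocycle f) (h0 : ∀ a ∈ A, f a = 0) (g a : G) (ha : a ∈ A) :
    f (g * a) = f g := by
  rw [hf.mul g a, h0 a ha, smul_zero, add_zero]

/-- H.2 TWIST TERM: with `A` central, acting trivially, `V^G = 0`, and «`H¹(G/A, V) = 0`» phrased as
«every cocycle of `G` vanishing on `A` is a coboundary», EVERY cocycle of `G` is a coboundary.
Dictionary: `G = Gal(K_m K(E′[3^∞])/K)`, `A = Gal(K_m K(E′[3^∞])/K(E′[3^∞])) ↪ Gal(K_m/K)`,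
`V = E′[3] ⊗ k`, `V^G ⊆ E′(K)[3] ⊗ k = 0`, `G/A = Gal(K(E′[3^∞])/K)`. -/
theorem H1_eq_zero_of_quotient (A : Subgroup G)
    (hAZ : A ≤ Subgroup.center G) (hAV : ∀ a ∈ A, ∀ v : V, a • v = v)
    (hVG : ∀ v : V, (∀ g : G, g • v = v) → v = 0)
    (hquot : ∀ f : G → V, IsOneCocycle f → (∀ a ∈ A, f a = 0) → IsOneCoboundary f)
    (f : G → V) (hf : IsOneCocycle f) : IsOneCoboundary f :=
  hquot f hf (cocycle_restrict_eq_zero A hAZ hAV hVG hf)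

/-- Centrality of `A` is automatic in the dictionary: if `r : G →* Γ` (restriction to `K_m`, `Γ` abelian) is
injective on `A` and `A` is normal, then `A` is central.  (`r (g a g⁻¹) = r a` in the abelian `Γ`.) -/
theorem central_of_injective_restriction {Γ : Type*} [CommGroup Γ] (r : G →* Γ) (A : Subgroup G)
    [hA : A.Normal] (hinj : ∀ a ∈ A, ∀ b ∈ A, r a = r b → a = b) : A ≤ Subgroup.center G := by
  intro a ha
  rw [Subgroup.mem_center_iff]
  intro g
  have hconj : g * a * g⁻¹ ∈ A := hA.conj_mem a ha g
  have hr : r (g * a * g⁻¹) = r a := by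
    rw [map_mul, map_mul, map_inv, mul_comm (r g) (r a), mul_assoc, mul_inv_cancel, mul_one]
  have := hinj _ hconj a ha hr
  -- g * a * g⁻¹ = a  ⇒  g * a = a * g
  calc g * a = g * a * g⁻¹ * g := by rw [inv_mul_cancel_right]
    _ = a * g := by rw [this]

end Cocycles

/-! ## §3  The coefficient involution is residually trivial (T-c) -/

section Involution

variable {R : Type*} [CommRing R]

/-- `ζ⁻¹ − ζ ∈ (1 − ζ)`: with `w ζ = 1`, `w − ζ = (1 − ζ)·(w (1 + ζ))`.  Hence `ι : ζ ↦ ζ⁻¹` on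
`O_χ = ℤ₃[ζ_{3^m}]` is the identity modulo `𝔪_χ = (1 − ζ)`, and the ι-semilinear bijection
`T ⊗ O_χ(χ) ≃ T ⊗ O_χ(χ̄)`, `t ⊗ α ↦ t ⊗ ι α` (G_K-equivariant since `ι ∘ χ = χ̄`), is the identity on
`T̄ ⊗ k`: the residual Bloch–Kato conditions of `T_χ` and `T_χ̄ = Tw(T_χ)` coincide — Howard's H.5(b). -/
theorem inv_sub_self_mem_span (ζ w : R) (hw : w * ζ = 1) :
    w - ζ ∈ Ideal.span ({1 - ζ} : Set R) := by
  rw [Ideal.mem_span_singleton]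
  exact ⟨w * (1 + ζ), by linear_combination ζ * hw⟩

/-- The same for any power: `ι(ζ^k) − ζ^k ∈ (1 − ζ)` (so `ι ≡ id` on all of `ℤ₃[ζ]` modulo `𝔪_χ`). -/
theorem inv_pow_sub_pow_mem_span (ζ w : R) (hw : w * ζ = 1) (k : ℕ) :
    w ^ k - ζ ^ k ∈ Ideal.span ({1 - ζ} : Set R) := by
  have h1 : w - ζ ∈ Ideal.span ({1 - ζ} : Set R) := inv_sub_self_mem_span ζ w hw
  have h2 : w - ζ ∣ w ^ k - ζ ^ k := sub_dvd_pow_sub_pow w ζ k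
  obtain ⟨q, hq⟩ := h2
  rw [hq]
  exact Ideal.mul_mem_right q _ h1

/-- … and the generator `1 − ζ` equals `ζ − 1` up to sign, the uniformiser of the card (`v_π(ζ − 1) = 1`). -/
theorem span_one_sub_eq_span_sub_one (ζ : R) :
    Ideal.span ({1 - ζ} : Set R) = Ideal.span ({ζ - 1} : Set R) := by
  rw [show (1 - ζ) = -(ζ - 1) by ring, Ideal.span_singleton_neg]

end Involution

/-! ## §4  Depth bookkeeping over the ramified `O_χ` (no loss): `v_π(ℓ+1) = e · v₃(ℓ+1)` -/

section Depth

/-- In a ring where `3 = u · π^e` with `u` a unit (e.g. `O_χ = ℤ₃[ζ_{3^m}]`, `e = φ(3^m)`), an integer of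
exact 3-adic valuation `v` is `unit · π^{e v}`: Kolyvagin depths `I_ℓ O_χ = (ℓ+1) O_χ = π^{e·v₃(ℓ+1)} O_χ`
scale by `e` exactly — Howard's `len_{O_χ}` bound loses nothing to ramification. -/
theorem three_pow_mul_eq_unit_mul_pi_pow {R : Type*} [CommRing R] (π u : R) (hu : IsUnit u) (e : ℕ)
    (h3 : (3 : R) = u * π ^ e) (v : ℕ) (n : R) (hn : IsUnit n) :
    ∃ u' : R, IsUnit u' ∧ (3 : R) ^ v * n = u' * π ^ (e * v) := by
  refine ⟨u ^ v * n, (hu.pow v).mul hn, ?_⟩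
  rw [h3, mul_pow, pow_mul]
  ring

end Depth

end Summit.BirchSwinnertonDyer.BirchSwinnertonDyer.Cruxes.TwinAlgMuZeroAtThree.OnePointSqueeze.TwistAudit
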